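import Summits.CriticalPhenomena.PercolationContinuityZ3.Theorems.PercNearOneGluingNoHeavyLowerTailSahiCTCN2Symm
import Summits.CriticalPhenomena.PercolationContinuityZ3.Theorems.PercNearOneGluingNoHeavyLowerTailSahiCTCN3NormalForm
import HarnessLib

/-!
# `NoHeavyLowerTail` (crux stmt-CriticalPhenomena-4575), P3 lane: RELABELLING SYMMETRY of the level-`c` certificate polynomial `Ñ_c` and of
# level-3 flag configurations

Support file (seat `prim-l12-p3`, gen 21; `--supports stmt-CriticalPhenomena-4575`).  Standard axioms.  Memo
`run/shared/lean/prim/prim-l12/FROM-prim-l12-p3-g21-*.md`.  Companion of `…SahiCTCN2Symm` (the case `c = 2`), whose relabelling calculus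
(`gf_map`, `filter_univPowerset_eq_map`, `flagCx_map`, `privPairs_map`, `pairsIn_map`, `cw_of_cw_rename`) is reused.

For a permutation `σ` of the ground type: `Ngen c (σK_X) (σK_Z) = rename σ (Ngen c K_X K_Z)` (`Ngen_map`); the level-3 flag complexes and
triangle families of `…SahiCTCN3NormalForm` relabel covariantly (`flagCx3_map`, `tri_map`); validity of a level-3 configuration is invariant
(`flagValid3_map`, `valid3_swap`) and nonnegativity of `Ñ₃` on a configuration descends from any relabelling and from the swap `X ↔ Z`
(`flagGood3_of_map`, `flagGood3_swap`).  Consequence: the finite check of `Ñ₃ ∈ ℕ[r]` over level-3 configurations may be restricted to one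
representative per orbit (used in `…SahiCTCN3Five`).  Nothing is asserted about the crux.
-/

namespace Summit.CriticalPhenomena.PercolationContinuityZ3.Theorems.SahiCTCForms

open Finset MvPolynomial SahiCTCGenFun

variable {α : Type*} [DecidableEq α] [Fintype α] (σ : Equiv.Perm α)

section families
variable (c : ℕ) (KX KZ : Finset (Finset α))

/-- `h`, `t`, `h_Y`, `e_Y` at level `c` relabel covariantly. [this work] -/
theorem faceFamiliesC_map :
    facesLE c (KX.map σ.finsetCongr.toEmbedding) = (facesLE c KX).map σ.finsetCongr.toEmbedding ∧
    facesGT c (KX.map σ.finsetCongr.toEmbedding) = (facesGT c KX).map σ.finsetCongr.toEmbedding ∧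
    commonLE c (KX.map σ.finsetCongr.toEmbedding) (KZ.map σ.finsetCongr.toEmbedding) = (commonLE c KX KZ).map σ.finsetCongr.toEmbedding ∧
    commonEQ c (KX.map σ.finsetCongr.toEmbedding) (KZ.map σ.finsetCongr.toEmbedding) = (commonEQ c KX KZ).map σ.finsetCongr.toEmbedding := by
  refine ⟨?_, ?_, ?_, ?_⟩
  · exact filter_univPowerset_eq_map σ fun S => by rw [card_map, map_mem_map_iff]
  · exact filter_univPowerset_eq_map σ fun S => by rw [card_map, map_mem_map_iff]
  · exact filter_univPowerset_eq_map σ fun S => by rw [card_map, map_mem_map_iff, map_mem_map_iff]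
  · exact filter_univPowerset_eq_map σ fun S => by rw [card_map, map_mem_map_iff, map_mem_map_iff]

/-- **`Ñ_c` relabels by `rename`**: `Ngen c (σK_X) (σK_Z) = rename σ (Ngen c K_X K_Z)`. [this work] -/
theorem Ngen_map : Ngen c (KX.map σ.finsetCongr.toEmbedding) (KZ.map σ.finsetCongr.toEmbedding) = rename σ (Ngen c KX KZ) := by
  obtain ⟨h1, h2, h3, h4⟩ := faceFamiliesC_map σ c KX KZ
  obtain ⟨h5, h6, -, -⟩ := faceFamiliesC_map σ c KZ KX
  have hPi : rename σ (PiP : MvPolynomial α ℤ) = PiP := by unfold PiP; rw [← gf_map, ← univPowerset_map]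
  have hDd : rename σ (DdC c : MvPolynomial α ℤ) = DdC c := by unfold DdC; rw [← gf_map, ← bySize_map]
  have hTh : rename σ (ThC c : MvPolynomial α ℤ) = ThC c := by unfold ThC; rw [← gf_map, ← bySize_map]
  have hec : rename σ (ee c : MvPolynomial α ℤ) = ee c := by unfold ee; rw [← gf_map, ← bySize_map]
  unfold Ngen
  simp only [map_add, map_sub, map_mul, hPi, hDd, hTh, hec, ← gf_map]
  rw [h1, h2, h3, h4, h5, h6]

end families

/-! ### Relabelling level-3 flag configurations -/

omit [DecidableEq α] [Fintype α] in
/-- Pulling a subset condition back along `σ`. [folklore] -/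
theorem forall_subset_map_iff {S : Finset α} {P : Finset α → Prop} :
    (∀ e, e ⊆ S.map σ.toEmbedding → P e) ↔ ∀ e, e ⊆ S → P (e.map σ.toEmbedding) := by
  constructor
  · intro h e he; exact h _ (map_subset_map.2 he)
  · intro h e he
    have he' : e.map σ.symm.toEmbedding ⊆ S := by
      have := (map_subset_map (f := σ.symm.toEmbedding)).2 he; rwa [map_map_symm] at this
    have := h _ he'
    rwa [map_symm_map] at this

/-- Triangle families relabel covariantly. [this work] -/
theorem tri_map (L : Finset α) (E : Finset (Finset α)) :
    tri (L.map σ.toEmbedding) (E.map σ.finsetCongr.toEmbedding) = (tri L E).map σ.finsetCongr.toEmbedding := by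
  unfold tri
  refine filter_univPowerset_eq_map σ fun S => ?_
  rw [card_map, map_subset_map]
  refine and_congr Iff.rfl (and_congr Iff.rfl ?_)
  simp only [mem_powerset]
  rw [forall_subset_map_iff]
  refine forall_congr' fun e => forall_congr' fun _ => ?_
  rw [card_map, map_mem_map_iff]

/-- Level-3 flag complexes relabel covariantly. [this work] -/
theorem flagCx3_map (L : Finset α) (E T : Finset (Finset α)) :
    flagCx3 (L.map σ.toEmbedding) (E.map σ.finsetCongr.toEmbedding) (T.map σ.finsetCongr.toEmbedding) =
      (flagCx3 L E T).map σ.finsetCongr.toEmbedding := by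
  unfold flagCx3
  refine filter_univPowerset_eq_map σ fun S => ?_
  rw [map_subset_map]
  refine and_congr Iff.rfl (and_congr ?_ ?_)
  · simp only [mem_powerset]
    rw [forall_subset_map_iff]
    refine forall_congr' fun e => forall_congr' fun _ => ?_
    rw [card_map, map_mem_map_iff]
  · simp only [mem_powerset]
    rw [forall_subset_map_iff]
    refine forall_congr' fun e => forall_congr' fun _ => ?_
    rw [card_map, map_mem_map_iff]

/-- **Validity of a level-3 configuration is invariant under relabelling.** [this work] -/
theorem flagValid3_map {LX LZ : Finset α} {A B TX TZ : Finset (Finset α)} (h1 : LX ∪ LZ = univ) (h2 : A ⊆ pairsIn (LX ∩ LZ))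
    (h3 : B ⊆ pairsIn (LX ∩ LZ)) (h4 : pairsIn (LX ∩ LZ) ⊆ A ∪ B) (h5 : TX ⊆ tri LX (privPairs LX LZ ∪ A))
    (h6 : TZ ⊆ tri LZ (privPairs LZ LX ∪ B)) (h7 : tri LX (privPairs LX LZ ∪ A) ∪ tri LZ (privPairs LZ LX ∪ B) ⊆ TX ∪ TZ) :
    LX.map σ.toEmbedding ∪ LZ.map σ.toEmbedding = univ ∧
    A.map σ.finsetCongr.toEmbedding ⊆ pairsIn (LX.map σ.toEmbedding ∩ LZ.map σ.toEmbedding) ∧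
    B.map σ.finsetCongr.toEmbedding ⊆ pairsIn (LX.map σ.toEmbedding ∩ LZ.map σ.toEmbedding) ∧
    pairsIn (LX.map σ.toEmbedding ∩ LZ.map σ.toEmbedding) ⊆ A.map σ.finsetCongr.toEmbedding ∪ B.map σ.finsetCongr.toEmbedding ∧
    TX.map σ.finsetCongr.toEmbedding ⊆
      tri (LX.map σ.toEmbedding) (privPairs (LX.map σ.toEmbedding) (LZ.map σ.toEmbedding) ∪ A.map σ.finsetCongr.toEmbedding) ∧
    TZ.map σ.finsetCongr.toEmbedding ⊆
      tri (LZ.map σ.toEmbedding) (privPairs (LZ.map σ.toEmbedding) (LX.map σ.toEmbedding) ∪ B.map σ.finsetCongr.toEmbedding) ∧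
    tri (LX.map σ.toEmbedding) (privPairs (LX.map σ.toEmbedding) (LZ.map σ.toEmbedding) ∪ A.map σ.finsetCongr.toEmbedding) ∪
      tri (LZ.map σ.toEmbedding) (privPairs (LZ.map σ.toEmbedding) (LX.map σ.toEmbedding) ∪ B.map σ.finsetCongr.toEmbedding) ⊆
      TX.map σ.finsetCongr.toEmbedding ∪ TZ.map σ.finsetCongr.toEmbedding := by
  obtain ⟨g1, g2, g3, g4⟩ := flagValid_map σ h1 h2 h3 h4
  refine ⟨g1, g2, g3, g4, ?_, ?_, ?_⟩
  · rw [privPairs_map, ← map_union, tri_map]; exact map_subset_map.2 h5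
  · rw [privPairs_map, ← map_union, tri_map]; exact map_subset_map.2 h6
  · rw [privPairs_map, privPairs_map, ← map_union, ← map_union, tri_map, tri_map, ← map_union, ← map_union]; exact map_subset_map.2 h7

/-- **Nonnegativity of `Ñ₃` on a level-3 configuration descends from its relabelling.** [this work] -/
theorem flagGood3_of_map {LX LZ : Finset α} {A B TX TZ : Finset (Finset α)}
    (h : ∀ n, 0 ≤ (Ngen 3
      (flagCx3 (LX.map σ.toEmbedding) (privPairs (LX.map σ.toEmbedding) (LZ.map σ.toEmbedding) ∪ A.map σ.finsetCongr.toEmbedding)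
        (TX.map σ.finsetCongr.toEmbedding))
      (flagCx3 (LZ.map σ.toEmbedding) (privPairs (LZ.map σ.toEmbedding) (LX.map σ.toEmbedding) ∪ B.map σ.finsetCongr.toEmbedding)
        (TZ.map σ.finsetCongr.toEmbedding))).coeff n)
    (n : α →₀ ℕ) : 0 ≤ (Ngen 3 (flagCx3 LX (privPairs LX LZ ∪ A) TX) (flagCx3 LZ (privPairs LZ LX ∪ B) TZ)).coeff n := by
  rw [privPairs_map, privPairs_map, ← map_union, ← map_union, flagCx3_map, flagCx3_map, Ngen_map] at h
  exact cw_of_cw_rename σ h n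

omit [DecidableEq α] [Fintype α] in
/-- **Nonnegativity of `Ñ₃` on a level-3 configuration is symmetric under the swap `X ↔ Z`.** [this work] -/
theorem flagGood3_swap [DecidableEq α] [Fintype α] {LX LZ : Finset α} {A B TX TZ : Finset (Finset α)}
    (h : ∀ n, 0 ≤ (Ngen 3 (flagCx3 LZ (privPairs LZ LX ∪ B) TZ) (flagCx3 LX (privPairs LX LZ ∪ A) TX)).coeff n) (n : α →₀ ℕ) :
    0 ≤ (Ngen 3 (flagCx3 LX (privPairs LX LZ ∪ A) TX) (flagCx3 LZ (privPairs LZ LX ∪ B) TZ)).coeff n := by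
  rw [Ngen_comm]; exact h n

/-- Swapping `X ↔ Z` preserves validity of a level-3 configuration. [this work] -/
theorem valid3_swap {LX LZ : Finset α} {A B TX TZ : Finset (Finset α)}
    (h : LX ∪ LZ = univ ∧ A ⊆ pairsIn (LX ∩ LZ) ∧ B ⊆ pairsIn (LX ∩ LZ) ∧ pairsIn (LX ∩ LZ) ⊆ A ∪ B ∧
      TX ⊆ tri LX (privPairs LX LZ ∪ A) ∧ TZ ⊆ tri LZ (privPairs LZ LX ∪ B) ∧
      tri LX (privPairs LX LZ ∪ A) ∪ tri LZ (privPairs LZ LX ∪ B) ⊆ TX ∪ TZ) :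
    LZ ∪ LX = univ ∧ B ⊆ pairsIn (LZ ∩ LX) ∧ A ⊆ pairsIn (LZ ∩ LX) ∧ pairsIn (LZ ∩ LX) ⊆ B ∪ A ∧
      TZ ⊆ tri LZ (privPairs LZ LX ∪ B) ∧ TX ⊆ tri LX (privPairs LX LZ ∪ A) ∧
      tri LZ (privPairs LZ LX ∪ B) ∪ tri LX (privPairs LX LZ ∪ A) ⊆ TZ ∪ TX := by
  obtain ⟨h1, h2, h3, h4, h5, h6, h7⟩ := h
  rw [union_comm] at h1; rw [inter_comm] at h2 h3 h4; rw [union_comm] at h4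
  rw [union_comm] at h7; rw [union_comm TX] at h7
  exact ⟨h1, h3, h2, h4, h6, h5, h7⟩

end Summit.CriticalPhenomena.PercolationContinuityZ3.Theorems.SahiCTCForms
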